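import Summits.ResolutionOfSingularities.ResolutionOfSingularities.Theorems.FrobeniusLadderFInjectiveMacaulayficationFDStorey2L1Fan
import Summits.ResolutionOfSingularities.ResolutionOfSingularities.Theorems.FrobeniusLadderFInjectiveMacaulayficationFDStorey2Specimen
import Summits.ResolutionOfSingularities.ResolutionOfSingularities.Theorems.FrobeniusLadderFInjectiveMacaulayficationP2d5CTauKBlowupFull
import HarnessLib

/-!
# BED D STOREY 2, LINE L1 (W8): THE BLOWING UP OF `V(G)` ALONG THE `𝔪_P`-PRIMARY TORIC CENTRE `K″` IS FULL AT EVERY POINT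
# (crux `FInjectiveMacaulayfication` stmt-ResolutionOfSingularities-15315, chain w45a; ROW #8 «f4pos_rowD_twoStorey», route of record (W8) — res-L1-w45a-plan-1 R21.29–R21.34,
# CHAIN v33.9; seat res-L1-w45a-stub-3 g11; data `FDStorey2L1Fan{Tables,TablesB,Checks,ChecksB,}` (certificate c79427d7cbc1bdce on res-L1-w45a-tri-2 g17's line-L1 fan,
# kit j318216); specimen facts `FDStorey2Specimen` (✓p663116/p663407); TEMPLATE = res-L1-w45a-stub-2 g9's `…Lx6c5PointKBlowupFull` §1–§2 verbatim with the names changed)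

[OURS · L1 W4.5a] Support file (`--supports stmt-ResolutionOfSingularities-15315 --as helper`); def-free, unconditional; replaces the role of NO printed item;
NOT a statement of the manuscript; AI-written (AI review is weaker than expert review).

WHY. BED D (`f_D = z⁴ + x⁵z + x⁶ + y³ + u³ + t⁷`, char 2) is the first bed of the ladder census that NO single toric storey cures (tri-2's THEOREM D-tor): storey 1 (`Bl_{𝔪·K} X`, res-L1-w45a-stub-2
g10's D-1 cells on tri-2's 327-chart fan) is FULL except at ONE closed point `P` of the exceptional divisor, where the local equation is
`G = Y₃² + Y₁³ + Y₂³ + Y₄Y₅⁴ + Y₄²Y₅ + Y₃Y₄Y₅⁴ + Y₃Y₄²Y₅` (chart 277, translated).  This file is STOREY 2: the blowing up of `V(G)` along the `𝔪_P`-primary monomial ideal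
`I_A = K″ = {Y^m : |m| ≥ 4, ⟨m,(2,2,2,2,1)⟩ ≥ 6, ⟨m,(2,2,3,3,1)⟩ ≥ 7}` (41 generators `FDStorey2L1Fan.A`; fan = Σ(𝔪_P) starred at (2,2,2,2,1) and (2,2,3,3,1), 15 unimodular charts, an
isomorphism off `P`) is FULL AT EVERY POINT — over `P` by the 15 kernel-checked whole-chart thin Fedder cells (F-pure; 10 of the charts are singular), off `P` because `V(G)` is regular
there.  With `Supp = {P}` this is exactly the `hfull` input of res-L1-w45a-stub-1's ✓p664865 `FHalfRowOfTwoStoreys.localSecondStorey_of_affineModel` / ✓p664558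
`fHalfConclusion_of_localSecondStorey` (row #8 assembly `…FDTwoStoreyRow`, stub-1).
SETTING. `R̄ = k[Y₁..Y₅]/(G)` (`X 0..X 4 = Y₁..Y₅`), `char k = 2`, `P` = the origin; `I_A ⊂ R̄` = the image of the monomial ideal of `FDStorey2L1Fan.A` (pinned as a `span` of an image).
* §1 `affineBlowup_mK_fullCl_over` — every stalk of `affineBlowup I_A` over `V(I_A)` is FULL (frame presentation; `CICertificates.ciCertificates` on the kernel-checked tables, `hon'` from
  `RoadBFrame.hon_of_kernelChecks`, `n = 5`, `t = 15`, + `PointFixableOfCert.affineBlowup_fiClause_over_of_cert`);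
* §2 `affineBlowup_mK_fullCl` (EVERY stalk FULL), `support_idealSheaf_mK` (`supp Ĩ_A = {P}`), `forall_isBlowup_mK_fullCl` (every blowing up along `Ĩ_A` is FULL at every point).
HONESTY. Output half only (a fact about `(V(G), P)`); the fan and its F-purity verdicts were FOUND by res-L1-w45a-tri-2 g17 (greedy «blow up the orbit carrying the non-F-pure locus», GF(2)
Gröbner bases, kit j318216); the support function is tri-2's; the certificate tables are this seat's (`build_cert_s3.py` = stub-2's toolkit with a (cones, h) entry). Nothing of
[claim: Hironaka2017] is used. [folklore glue; cite: Fedder1983, Thm. 1.12; StacksProject, Tag 0804; StacksProject, Tag 080A; GortzWedhorn2020, Prop. 13.91 and Prop. 13.92;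
CoxLittleSchenck2011, §2.3]
-/

-- single-problem summit: the doubled namespace component is forced
set_option linter.dupNamespace false

noncomputable section

open AlgebraicGeometry CategoryTheory Literature.AlgebraicGeometry.Resolution TopologicalSpace IsLocalRing MvPolynomial

namespace Summit.ResolutionOfSingularities.ResolutionOfSingularities.Theorems.FInjectiveMacaulayfication.FDStorey2L1BlowupFull

open Summit.ResolutionOfSingularities.ResolutionOfSingularities.Theorems.FInjectiveMacaulayfication
open SliceableCentre FDStorey2Specimen

/-! ## §1 Over the centre, in the frame's presentation `k[X]/(Set.range ![f])` -/

set_option maxHeartbeats 800000 in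
-- the frame's binder block is large; instantiation is by name
/-- **Every stalk of `affineBlowup I_A` OVER `V(I_A)` is FULL** (frame presentation `k[X]/(Set.range Fs)`, `Fs = ![f]`): the road-B certificate
(`CICertificates.ciCertificates` on `FDStorey2L1Fan`'s kernel-checked tables, `hon'` from `RoadBFrame.hon_of_kernelChecks` at `n = 5`, `t = 15`) fed to
`PointFixableOfCert.affineBlowup_fiClause_over_of_cert`. [folklore glue; cite: Fedder1983, Thm. 1.12; StacksProject, Tag 0804] -/
theorem affineBlowup_mK_fullCl_over (k : Type) [Field k] [CharP k 2] (Fs : Fin 1 → MvPolynomial (Fin 5) k)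
    (hFs : Fs = ![X 2 ^ 2 + X 0 ^ 3 + X 1 ^ 3 + X 3 * X 4 ^ 4 + X 3 ^ 2 * X 4 + X 2 * X 3 * X 4 ^ 4 + X 2 * X 3 ^ 2 * X 4]) :
    ∀ y : ↥(affineBlowup (Ideal.span ((fun e : Fin 5 →₀ ℕ => Ideal.Quotient.mk (Ideal.span (Set.range Fs)) (monomial e (1 : k))) ''
        (FDStorey2L1Fan.A : Set (Fin 5 →₀ ℕ))))),
      Ideal.span ((fun e : Fin 5 →₀ ℕ => Ideal.Quotient.mk (Ideal.span (Set.range Fs)) (monomial e (1 : k))) ''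
          (FDStorey2L1Fan.A : Set (Fin 5 →₀ ℕ))) ≤
        ((affineBlowup.π (Ideal.span ((fun e : Fin 5 →₀ ℕ => Ideal.Quotient.mk (Ideal.span (Set.range Fs)) (monomial e (1 : k))) ''
          (FDStorey2L1Fan.A : Set (Fin 5 →₀ ℕ))))).base y).asIdeal →
      FullCl 2 ((affineBlowup (Ideal.span ((fun e : Fin 5 →₀ ℕ => Ideal.Quotient.mk (Ideal.span (Set.range Fs)) (monomial e (1 : k))) ''
        (FDStorey2L1Fan.A : Set (Fin 5 →₀ ℕ))))).presheaf.stalk y) := by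
  classical
  haveI : Fact (Nat.Prime 2) := ⟨Nat.prime_two⟩
  subst hFs
  set f : MvPolynomial (Fin 5) k := X 2 ^ 2 + X 0 ^ 3 + X 1 ^ 3 + X 3 * X 4 ^ 4 + X 3 ^ 2 * X 4 + X 2 * X 3 * X 4 ^ 4 + X 2 * X 3 ^ 2 * X 4 with hf
  have hr : Set.range (![f] : Fin 1 → MvPolynomial (Fin 5) k) = {f} := LevelTwoBlockTranslate.range_vec_one f
  have hfprime : (Ideal.span {f}).IsPrime := (Ideal.span_singleton_prime (prime_f k f hf).ne_zero).mpr (prime_f k f hf)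
  haveI hpr : (Ideal.span (Set.range (![f] : Fin 1 → MvPolynomial (Fin 5) k))).IsPrime := by rw [hr]; exact hfprime
  haveI : IsDomain (MvPolynomial (Fin 5) k ⧸ Ideal.span (Set.range (![f] : Fin 1 → MvPolynomial (Fin 5) k))) := Ideal.Quotient.isDomain _
  haveI : CharP (MvPolynomial (Fin 5) k ⧸ Ideal.span (Set.range (![f] : Fin 1 → MvPolynomial (Fin 5) k))) 2 :=
    charP_of_injective_algebraMap (algebraMap k _).injective 2
  have hXne : ∀ v : Fin 5, Ideal.Quotient.mk (Ideal.span (Set.range (![f] : Fin 1 → MvPolynomial (Fin 5) k))) (X v) ≠ 0 := by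
    intro v h0
    have hmem : (X v : MvPolynomial (Fin 5) k) ∈ Ideal.span (Set.range (![f] : Fin 1 → MvPolynomial (Fin 5) k)) :=
      Ideal.Quotient.eq_zero_iff_mem.mp h0
    rw [hr] at hmem
    exact mk_X_ne_zero k f hf v (Ideal.Quotient.eq_zero_iff_mem.mpr hmem)
  have hθF' : ∀ (c : Fin 15) (l : Fin 1), aeval (fun j : Fin 5 => ∏ i : Fin 5, (X i : MvPolynomial (Fin 5) k) ^ FDStorey2L1Fan.V c i j)
      ((![f] : Fin 1 → MvPolynomial (Fin 5) k) l) =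
      monomial (FDStorey2L1Fan.d c l) (1 : k) *
        (fun c : Fin 15 => (![KLocCellKit.evalL k (FDStorey2L1Fan.G c)] : Fin 1 → MvPolynomial (Fin 5) k)) c l := by
    intro c l
    fin_cases l
    exact FDStorey2L1Fan.hθF₀ k c
  have hon := RoadBFrame.hon_of_kernelChecks 2 k 5 15 FDStorey2L1Fan.V FDStorey2L1Fan.G (FDStorey2L1Fan.hg0 k)
    (FDStorey2L1Fan.hX k) FDStorey2L1Fan.CELLS FDStorey2L1Fan.hcheck FDStorey2L1Fan.hSS
  obtain ⟨hcovR, hv0, hon'⟩ := CICertificates.ciCertificates 2 k Finset.univ FDStorey2L1Fan.A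
    FDStorey2L1Fan.hprimAJ.2.1 15
    FDStorey2L1Fan.m (FDStorey2L1Fan.hcov k) FDStorey2L1Fan.V FDStorey2L1Fan.hV FDStorey2L1Fan.a
    FDStorey2L1Fan.haA FDStorey2L1Fan.hgen FDStorey2L1Fan.hge (![f] : Fin 1 → MvPolynomial (Fin 5) k) hpr hXne
    (fun c : Fin 15 => (![KLocCellKit.evalL k (FDStorey2L1Fan.G c)] : Fin 1 → MvPolynomial (Fin 5) k)) FDStorey2L1Fan.d hθF'
    FDStorey2L1Fan.hunit hon (FDStorey2L1Fan.hv k _)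
  intro y hy
  exact PointFixableOfCert.affineBlowup_fiClause_over_of_cert 2 _ _ 15 _ (FDStorey2L1Fan.hv k _) hcovR hv0 hon' y hy

/-! ## §2 ★★ Everywhere, in the presentation `k[X]/(f)`; the support; every blowing up -/

set_option maxHeartbeats 800000 in
-- presentation rewrite + one blow-up-is-iso transport
/-- ★★ **THE BLOWING UP OF `V(G) ⊂ 𝔸⁵_k` (`char k = 2`; the storey-1 chart model of BED D at `P`) ALONG THE `𝔪_P`-PRIMARY MONOMIAL CENTRE `I_A = K″` (tri-2's line L1) IS FULL AT EVERY POINT**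
(explicit model `affineBlowup I_A`, centre PINNED as the image of `(x^e : e ∈ FDStorey2L1Fan.A)`): over the vertex by §1; elsewhere `X` is regular
(`FDStorey2Specimen.regular_off_vertex`) and the blow-up is a local isomorphism (`IsBlowup.isIso_compl`), so the stalk is regular, hence FULL. Over `P` the blow-up is
F-pure but NOT regular (10 singular charts): FULL is certified by the Fedder cells, not by regularity. [OURS · certificate instance; cite: Fedder1983, Thm. 1.12; StacksProject, Tag 0804; GortzWedhorn2020, Prop. 13.91] -/
theorem affineBlowup_mK_fullCl (k : Type) [Field k] [CharP k 2] (f : MvPolynomial (Fin 5) k)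
    (hf : f = X 2 ^ 2 + X 0 ^ 3 + X 1 ^ 3 + X 3 * X 4 ^ 4 + X 3 ^ 2 * X 4 + X 2 * X 3 * X 4 ^ 4 + X 2 * X 3 ^ 2 * X 4) :
    ∀ y : ↥(affineBlowup (Ideal.span ((fun e : Fin 5 →₀ ℕ => Ideal.Quotient.mk (Ideal.span {f}) (monomial e (1 : k))) ''
        (FDStorey2L1Fan.A : Set (Fin 5 →₀ ℕ))))),
      FullCl 2 ((affineBlowup (Ideal.span ((fun e : Fin 5 →₀ ℕ => Ideal.Quotient.mk (Ideal.span {f}) (monomial e (1 : k))) ''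
        (FDStorey2L1Fan.A : Set (Fin 5 →₀ ℕ))))).presheaf.stalk y) := by
  classical
  haveI : Fact (Nat.Prime 2) := ⟨Nat.prime_two⟩
  subst hf
  -- §1 in the presentation `k[X]/(f)`
  have hover := affineBlowup_mK_fullCl_over k _ rfl
  rw [LevelTwoBlockTranslate.range_vec_one] at hover
  set f : MvPolynomial (Fin 5) k := X 2 ^ 2 + X 0 ^ 3 + X 1 ^ 3 + X 3 * X 4 ^ 4 + X 3 ^ 2 * X 4 + X 2 * X 3 * X 4 ^ 4 + X 2 * X 3 ^ 2 * X 4 with hf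
  haveI hfprime : (Ideal.span {f}).IsPrime := (Ideal.span_singleton_prime (prime_f k f hf).ne_zero).mpr (prime_f k f hf)
  haveI : IsDomain (MvPolynomial (Fin 5) k ⧸ Ideal.span {f}) := Ideal.Quotient.isDomain _
  set I : Ideal (MvPolynomial (Fin 5) k ⧸ Ideal.span {f}) :=
    Ideal.span ((fun e : Fin 5 →₀ ℕ => Ideal.Quotient.mk (Ideal.span {f}) (monomial e (1 : k))) '' (FDStorey2L1Fan.A : Set (Fin 5 →₀ ℕ))) with hI
  intro y
  by_cases hy : I ≤ ((affineBlowup.π I).base y).asIdeal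
  · exact hover y hy
  · -- off the vertex: `X` regular there and `π` an isomorphism over the complement of `V(I) = {vertex}`
    have hvert : ¬ Ideal.span (Set.range fun j : Fin 5 => Ideal.Quotient.mk (Ideal.span {f}) (X j)) ≤ ((affineBlowup.π I).base y).asIdeal := by
      intro hle
      exact hy ((CICertificates.centre_le_iff (Ideal.span {f}) Finset.univ FDStorey2L1Fan.A FDStorey2L1Fan.hprimAJ.1
        FDStorey2L1Fan.hprimAJ.2.1 _).mpr fun j _ => hle (Ideal.subset_span ⟨j, rfl⟩))
    have hreg : (affineBlowup.π I).base y ∈ Scheme.regularLocus (Spec (.of (MvPolynomial (Fin 5) k ⧸ Ideal.span {f}))) :=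
      FermatCubicConeGerm.mem_regularLocus_Spec_of_isRegularLocalRing _ (regular_off_vertex k f hf _ hvert)
    have hsupp : (affineBlowup.π I).base y ∉ ((affineBlowup.idealSheaf I).support : Set (Spec (.of (MvPolynomial (Fin 5) k ⧸ Ideal.span {f})))) := by
      rw [affineBlowup.support_idealSheaf]
      exact fun h => hy fun r hr => h hr
    haveI := (affineBlowup.isBlowup I).isIso_compl
    let U : (Spec (.of (MvPolynomial (Fin 5) k ⧸ Ideal.span {f}))).Opens :=
      ⟨((affineBlowup.idealSheaf I).support : Set (Spec (.of (MvPolynomial (Fin 5) k ⧸ Ideal.span {f}))))ᶜ,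
        (affineBlowup.idealSheaf I).support.isClosed.isOpen_compl⟩
    have hyU : (affineBlowup.π I).base y ∈ U := hsupp
    have hreg' : y ∈ Scheme.regularLocus (affineBlowup I) :=
      (mem_regularLocus_iff_of_isIso_morphismRestrict (affineBlowup.π I) U y hyU).mpr hreg
    rw [Scheme.mem_regularLocus] at hreg'
    haveI := hreg'
    haveI := FTemkinClosedPoints.charP_stalk_of_over 2
      (Spec.map (CommRingCat.ofHom (algebraMap k (MvPolynomial (Fin 5) k ⧸ Ideal.span {f})))) (affineBlowup.π I) y
    exact FTemkinClosedPoints.fullCl_of_isRegularLocalRing 2 _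

/-- **The support of the centre `Ĩ_A` is the vertex** (the monomial ideal is `𝔪`-primary: pure powers of all five variables lie in `A`).
[folklore; cite: StacksProject, Tag 0804] -/
theorem support_idealSheaf_mK (k : Type) [Field k] (f : MvPolynomial (Fin 5) k)
    (hf : f = X 2 ^ 2 + X 0 ^ 3 + X 1 ^ 3 + X 3 * X 4 ^ 4 + X 3 ^ 2 * X 4 + X 2 * X 3 * X 4 ^ 4 + X 2 * X 3 ^ 2 * X 4)
    (v : Spec (.of (MvPolynomial (Fin 5) k ⧸ Ideal.span {f})))
    (hv : v.asIdeal = Ideal.span (Set.range fun j : Fin 5 => Ideal.Quotient.mk (Ideal.span {f}) (X j))) :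
    ((affineBlowup.idealSheaf (Ideal.span ((fun e : Fin 5 →₀ ℕ => Ideal.Quotient.mk (Ideal.span {f}) (monomial e (1 : k))) ''
        (FDStorey2L1Fan.A : Set (Fin 5 →₀ ℕ))))).support : Set (Spec (.of (MvPolynomial (Fin 5) k ⧸ Ideal.span {f})))) = {v} := by
  have hmax : v.asIdeal.IsMaximal := by
    rw [hv]; exact DoublePointFermatCubicGerm.isMaximal_origin k f (constantCoeff_f k f hf)
  rw [affineBlowup.support_idealSheaf]
  ext w
  change ((Ideal.span ((fun e : Fin 5 →₀ ℕ => Ideal.Quotient.mk (Ideal.span {f}) (monomial e (1 : k))) ''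
      (FDStorey2L1Fan.A : Set (Fin 5 →₀ ℕ))) : Ideal (MvPolynomial (Fin 5) k ⧸ Ideal.span {f})) :
      Set (MvPolynomial (Fin 5) k ⧸ Ideal.span {f})) ⊆ (w.asIdeal : Set (MvPolynomial (Fin 5) k ⧸ Ideal.span {f})) ↔ w = v
  rw [SetLike.coe_subset_coe,
    CICertificates.centre_le_iff (Ideal.span {f}) Finset.univ FDStorey2L1Fan.A FDStorey2L1Fan.hprimAJ.1
      FDStorey2L1Fan.hprimAJ.2.1]
  constructor
  · intro h
    have hle : v.asIdeal ≤ w.asIdeal := by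
      rw [hv, Ideal.span_le]
      rintro _ ⟨j, rfl⟩
      exact h j (Finset.mem_univ j)
    exact PrimeSpectrum.ext (hmax.eq_of_le w.isPrime.ne_top hle).symm
  · rintro rfl j _
    rw [hv]
    exact Ideal.subset_span ⟨j, rfl⟩

/-- ★★ **EVERY BLOWING UP OF `X` ALONG `Ĩ_A` IS FULL AT EVERY POINT** — the pinned-centre, universally-quantified form (any two blowings up along the same centre are
isomorphic over `X`, `IsBlowup.unique`; FULL moves along isomorphic stalks). [OURS · certificate instance; cite: GortzWedhorn2020, Prop. 13.92] -/
theorem forall_isBlowup_mK_fullCl (k : Type) [Field k] [CharP k 2] (f : MvPolynomial (Fin 5) k)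
    (hf : f = X 2 ^ 2 + X 0 ^ 3 + X 1 ^ 3 + X 3 * X 4 ^ 4 + X 3 ^ 2 * X 4 + X 2 * X 3 * X 4 ^ 4 + X 2 * X 3 ^ 2 * X 4) :
    affineBlowup.idealSheaf (Ideal.span ((fun e : Fin 5 →₀ ℕ => Ideal.Quotient.mk (Ideal.span {f}) (monomial e (1 : k))) ''
        (FDStorey2L1Fan.A : Set (Fin 5 →₀ ℕ)))) ≠ ⊥ ∧
    ∀ (X' : Scheme.{0}) (π : X' ⟶ Spec (.of (MvPolynomial (Fin 5) k ⧸ Ideal.span {f}))),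
      IsBlowup π (affineBlowup.idealSheaf (Ideal.span ((fun e : Fin 5 →₀ ℕ => Ideal.Quotient.mk (Ideal.span {f}) (monomial e (1 : k))) ''
        (FDStorey2L1Fan.A : Set (Fin 5 →₀ ℕ))))) →
      ∀ x' : X', FullCl 2 (X'.presheaf.stalk x') := by
  haveI hfprime : (Ideal.span {f}).IsPrime := (Ideal.span_singleton_prime (prime_f k f hf).ne_zero).mpr (prime_f k f hf)
  haveI : IsDomain (MvPolynomial (Fin 5) k ⧸ Ideal.span {f}) := Ideal.Quotient.isDomain _
  have hIne : Ideal.span ((fun e : Fin 5 →₀ ℕ => Ideal.Quotient.mk (Ideal.span {f}) (monomial e (1 : k))) ''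
      (FDStorey2L1Fan.A : Set (Fin 5 →₀ ℕ))) ≠ ⊥ := by
    intro h0
    have hmem := FDStorey2L1Fan.hv k ![f] 0
    rw [LevelTwoBlockTranslate.range_vec_one] at hmem
    rw [h0] at hmem
    have hzero := (Submodule.mem_bot _).mp hmem
    apply (show Ideal.Quotient.mk (Ideal.span {f}) (monomial (FDStorey2L1Fan.m 0) (1 : k)) ≠ 0 from ?_) hzero
    rw [monomial_eq, C_1, one_mul, Finsupp.prod, map_prod]
    exact Finset.prod_ne_zero_iff.mpr fun j _ => by rw [map_pow]; exact pow_ne_zero _ (mk_X_ne_zero k f hf j)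
  haveI := affineBlowup.isIntegral hIne
  refine ⟨RegularBlowupModelDim2.ne_bot_of_isBlowup (affineBlowup.isBlowup _), fun X' π hπ x' => ?_⟩
  obtain ⟨e, -, -⟩ := (affineBlowup.isBlowup _).unique hπ
  exact FTemkinClosedPoints.fullCl_of_isIso_stalkMap' 2 e.inv x' (affineBlowup_mK_fullCl k f hf (e.inv.base x'))

end Summit.ResolutionOfSingularities.ResolutionOfSingularities.Theorems.FInjectiveMacaulayfication.FDStorey2L1BlowupFull

end
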